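import Literature.MeasureTheory.Integral.ContinuousKernelPeriod
import HarnessLib

/-!
# The lift operator `f ↦ ∫ K(·, q) f(q) dμ(q)` of a continuous kernel on a product of compact spaces

Topic `MeasureTheory/Integral`; namespace `Literature.MeasureTheory.Integral.KernelOp` (continues
`ContinuousKernelPeriod`). Elementary Banach-space-valued integration, in Mathlib generality; every
statement is kernel-proved, nothing is cited beyond textbook functional analysis.

For compact spaces `X`, `Q`, a finite Borel measure `μ` on `Q` and a continuous kernel `K ∈ C(X × Q, ℂ)`:

* `lift μ K f ∈ C(X, ℂ)` for `f ∈ C(Q, ℂ)` — the special case `period μ f id K = ∫ f(q) • K(·, q) dμ(q)` of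
  the period operator of `ContinuousKernelPeriod` (a `C(X, ℂ)`-valued Bochner integral), with
  `lift_apply : lift μ K f x = ∫ K(x, q) f(q) dμ(q)`; bilinear and bounded,
  `‖lift μ K f‖ ≤ μ(Q) ‖K‖ ‖f‖` (`norm_lift_le`), a bounded bilinear map (`isBoundedBilinearMap_lift`),
  hence jointly continuous in `(K, f)` (`continuous_lift₂`), packaged as
  `liftL μ : C(X × Q, ℂ) →L[ℂ] C(Q, ℂ) →L[ℂ] C(X, ℂ)`;
* substitution laws: in the `X`-variable along any continuous `a : A → X` (`lift_pullback`:
  `lift μ (K ∘ (a × id)) f = (lift μ K f) ∘ a`), and in the `Q`-variable under a measure-preserving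
  action (`lift_eq_of_smul_invariant`: if `K'(x, q) = K(x, g • q)`, `f'(q) = f(g • q)` and `μ` is
  `g`-invariant then `lift μ K' f' = lift μ K f`);
* the FINITE-SUM form (`integral_comp_eq_sum_fiber`, `lift_apply_eq_sum`): if the integrand
  `q ↦ K(x, q) f(q)` factors through a map `c : Q → C` to a finite type with measurable fibres (e.g. the
  orbit map of an open subgroup acting on a compact quotient), then
  `lift μ K f x = Σ_{i ∈ C} μ(c⁻¹{i}) · K(x, rep i) f(rep i)` for any section `rep` of `c`;
* ADJOINTNESS without Fubini (`integral_lift_mul`): for a finite Borel measure `ν` on `X` and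
  `F ∈ C(X, ℂ)`, `∫ (lift μ K f)(x) F(x) dν(x) = ∫ f(q) (lift ν Kᵗ F)(q) dμ(q)` with `Kᵗ(q, x) = K(x, q)` —
  proved by commuting the continuous linear functional `pairing ν F : φ ↦ ∫ φ F dν` with the Bochner
  integral ([DeitmarEchterhoff2014, §B.6] / Mathlib `ContinuousLinearMap.integral_comp_comm`), so no
  product-measurability or second-countability hypothesis is needed; and its pulled-back ("seesaw-shaped")
  form `integral_lift_comp_mul` along `a : A → X`.

The motivating instance is the theta lift `Θ_Φ(f)(ξ) = ∫_{[G]} θ_Φ(ξ, q) f(q) dq` of a continuous theta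
kernel on a product of two compact adelic quotients (file `NumberTheory/Weil1964/ThetaLift`), whose
level, equivariance, finite-sum and adjointness laws are the specialisations of the laws above.

## Mathlib / tree

Tree: `ContinuousKernelPeriod` (`sliceQ`, `period`, `period_apply'`, `period_add`, `period_smul`,
`norm_period_le`, `integrable_smul_sliceQ`). Mathlib: `IsBoundedBilinearMap.continuous`,
`IsBoundedBilinearMap.toContinuousLinearMap`, `MeasureTheory.integral_smul_eq_self`, `integral_finsetSum`,
`integral_indicator_const`, `ContinuousLinearMap.integral_comp_comm`,
`Continuous.integrable_of_hasCompactSupport`. Nothing in Mathlib or the tree is duplicated: Mathlib has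
no named operator `f ↦ ∫ K(·, q) f(q) dμ` with values in `C(X, ℂ)`.

Provenance: written for the HodgeCM PerL cell `pub-hodgecm` (model-construction node W6a, theta lift)
under the LEAN-IN-TREE rule; nothing here is a claim of the manuscripts adjudicated by that cell.

## References

* A. Deitmar, S. Echterhoff, *Principles of Harmonic Analysis*, 2nd ed., Springer (2014), Appendix B.6
  (continuous linear maps commute with the Bochner integral) [DeitmarEchterhoff2014].
-/

noncomputable section

open _root_.MeasureTheory Set Filter Function
open scoped ENNReal

namespace Literature.MeasureTheory.Integral

namespace KernelOp

/-! ## 0. Two kernels on points -/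

section Points

variable {X Q A : Type*} [TopologicalSpace X] [TopologicalSpace Q] [TopologicalSpace A]

/-- The kernel pulled back along `a : A → X` in the first variable, on points. [folklore] -/
@[simp] theorem comp_prodMap_id_apply (K : C(X × Q, ℂ)) (a : C(A, X)) (p : A × Q) :
    K.comp (a.prodMap (ContinuousMap.id Q)) p = K (a p.1, p.2) := rfl

/-- The transposed kernel `Kᵗ(q, x) = K(x, q)` on points. [folklore] -/
@[simp] theorem comp_prodSwap_apply (K : C(X × Q, ℂ)) (q : Q) (x : X) :
    K.comp ContinuousMap.prodSwap (q, x) = K (x, q) := rfl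

end Points

/-! ## 1. The lift operator and its bilinear structure -/

section LiftDef

variable {X Q : Type*} [TopologicalSpace X] [CompactSpace X] [TopologicalSpace Q] [MeasurableSpace Q]
  (μ : Measure Q)

/-- **The lift of `f ∈ C(Q, ℂ)` by the kernel `K`**: `lift μ K f := ∫ f(q) • K(·, q) dμ(q) ∈ C(X, ℂ)`,
the period of `ContinuousKernelPeriod` with weight `f` along `id : Q → Q`. [folklore] -/
def lift (K : C(X × Q, ℂ)) (f : C(Q, ℂ)) : C(X, ℂ) := period μ f id K

/-- `lift` is the period with weight `f` along `id`. [folklore] -/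
theorem lift_eq_period (K : C(X × Q, ℂ)) (f : C(Q, ℂ)) : lift μ K f = period μ f id K := rfl

/-- Unfolding `lift` as a `C(X, ℂ)`-valued Bochner integral. [folklore] -/
theorem lift_def (K : C(X × Q, ℂ)) (f : C(Q, ℂ)) : lift μ K f = ∫ q, f q • sliceQ K q ∂μ := rfl

/-- Homogeneity in the kernel. [folklore] -/
theorem lift_smul_left (c : ℂ) (K : C(X × Q, ℂ)) (f : C(Q, ℂ)) :
    lift μ (c • K) f = c • lift μ K f :=
  period_smul μ c K

/-- Homogeneity in the weight. [folklore] -/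
theorem lift_smul_right (c : ℂ) (K : C(X × Q, ℂ)) (f : C(Q, ℂ)) :
    lift μ K (c • f) = c • lift μ K f := by
  rw [lift_def, lift_def, ← integral_smul]
  refine integral_congr_ae (Eventually.of_forall fun q => ?_)
  simp only [ContinuousMap.smul_apply, smul_eq_mul, mul_smul]

end LiftDef

section Lift

variable {X Q : Type*} [TopologicalSpace X] [CompactSpace X] [TopologicalSpace Q] [CompactSpace Q]
  [MeasurableSpace Q] [OpensMeasurableSpace Q] (μ : Measure Q) [IsFiniteMeasure μ]

/-- The `C(X, ℂ)`-valued integrand of `lift` is integrable (continuous weight on a compact space,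
finite measure). [folklore] -/
theorem integrable_smul_sliceQ_id (K : C(X × Q, ℂ)) (f : C(Q, ℂ)) :
    Integrable (fun q => f q • sliceQ K q) μ :=
  integrable_smul_sliceQ μ f.continuous (HasCompactSupport.of_compactSpace _) continuous_id K

/-- **Pointwise evaluation**: `lift μ K f x = ∫ K(x, q) f(q) dμ(q)`. [folklore] -/
theorem lift_apply (K : C(X × Q, ℂ)) (f : C(Q, ℂ)) (x : X) :
    lift μ K f x = ∫ q, K (x, q) * f q ∂μ := by
  rw [lift_eq_period, period_apply' μ f.continuous (HasCompactSupport.of_compactSpace _) continuous_id K x]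
  exact integral_congr_ae (Eventually.of_forall fun q => mul_comm _ _)

/-- Pointwise evaluation, weight first: `lift μ K f x = ∫ f(q) K(x, q) dμ(q)`. [folklore] -/
theorem lift_apply' (K : C(X × Q, ℂ)) (f : C(Q, ℂ)) (x : X) :
    lift μ K f x = ∫ q, f q * K (x, q) ∂μ :=
  period_apply' μ f.continuous (HasCompactSupport.of_compactSpace _) continuous_id K x

/-- Additivity in the kernel. [folklore] -/
theorem lift_add_left (K K' : C(X × Q, ℂ)) (f : C(Q, ℂ)) :
    lift μ (K + K') f = lift μ K f + lift μ K' f :=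
  period_add μ f.continuous (HasCompactSupport.of_compactSpace _) continuous_id K K'

/-- Additivity in the weight. [folklore] -/
theorem lift_add_right (K : C(X × Q, ℂ)) (f f' : C(Q, ℂ)) :
    lift μ K (f + f') = lift μ K f + lift μ K f' := by
  rw [lift_def, lift_def, lift_def,
    ← integral_add (integrable_smul_sliceQ_id μ K f) (integrable_smul_sliceQ_id μ K f')]
  refine integral_congr_ae (Eventually.of_forall fun q => ?_)
  simp only [ContinuousMap.add_apply, add_smul]

/-- **The operator bound** `‖lift μ K f‖ ≤ μ(Q) ‖K‖ ‖f‖`. [folklore] -/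
theorem norm_lift_le (K : C(X × Q, ℂ)) (f : C(Q, ℂ)) :
    ‖lift μ K f‖ ≤ μ.real univ * ‖K‖ * ‖f‖ := by
  have h1 := norm_period_le μ f.continuous (HasCompactSupport.of_compactSpace _) id K
  have h2 : ∫ q, ‖f q‖ ∂μ ≤ μ.real univ * ‖f‖ := by
    calc ∫ q, ‖f q‖ ∂μ ≤ ∫ _, ‖f‖ ∂μ :=
          integral_mono_of_nonneg (Eventually.of_forall fun _ => norm_nonneg _) (integrable_const _)
            (Eventually.of_forall fun q => f.norm_coe_le_norm q)
      _ = μ.real univ * ‖f‖ := by rw [integral_const, smul_eq_mul]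
  calc ‖lift μ K f‖ ≤ (∫ q, ‖f q‖ ∂μ) * ‖K‖ := h1
    _ ≤ (μ.real univ * ‖f‖) * ‖K‖ := mul_le_mul_of_nonneg_right h2 (norm_nonneg _)
    _ = μ.real univ * ‖K‖ * ‖f‖ := by ring

/-- **The lift is a bounded bilinear map** `C(X × Q, ℂ) × C(Q, ℂ) → C(X, ℂ)`. [folklore] -/
theorem isBoundedBilinearMap_lift :
    IsBoundedBilinearMap ℂ (fun p : C(X × Q, ℂ) × C(Q, ℂ) => lift μ p.1 p.2) where
  add_left K K' f := lift_add_left μ K K' f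
  smul_left c K f := lift_smul_left μ c K f
  add_right K f f' := lift_add_right μ K f f'
  smul_right c K f := lift_smul_right μ c K f
  bound := by
    refine ⟨μ.real univ + 1, add_pos_of_nonneg_of_pos measureReal_nonneg one_pos,
      fun K f => (norm_lift_le μ K f).trans ?_⟩
    have h1 : μ.real univ ≤ μ.real univ + 1 := le_add_of_nonneg_right zero_le_one
    exact mul_le_mul_of_nonneg_right (mul_le_mul_of_nonneg_right h1 (norm_nonneg K)) (norm_nonneg f)

/-- **Joint continuity** of `(K, f) ↦ lift μ K f` (sup-norm topologies). [folklore] -/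
theorem continuous_lift₂ : Continuous fun p : C(X × Q, ℂ) × C(Q, ℂ) => lift μ p.1 p.2 :=
  (isBoundedBilinearMap_lift μ).continuous

/-- Continuity in the kernel. [folklore] -/
theorem continuous_lift_left (f : C(Q, ℂ)) : Continuous fun K : C(X × Q, ℂ) => lift μ K f :=
  (continuous_lift₂ μ).comp (continuous_id.prodMk continuous_const)

/-- Continuity in the weight. [folklore] -/
theorem continuous_lift_right (K : C(X × Q, ℂ)) : Continuous fun f : C(Q, ℂ) => lift μ K f :=
  (continuous_lift₂ μ).comp (continuous_const.prodMk continuous_id)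

/-- **The lift as a continuous bilinear map** `C(X × Q, ℂ) →L[ℂ] C(Q, ℂ) →L[ℂ] C(X, ℂ)`. [folklore] -/
def liftL : C(X × Q, ℂ) →L[ℂ] C(Q, ℂ) →L[ℂ] C(X, ℂ) :=
  (isBoundedBilinearMap_lift μ).toContinuousLinearMap

/-- `liftL` is `lift`. [folklore] -/
@[simp] theorem liftL_apply (K : C(X × Q, ℂ)) (f : C(Q, ℂ)) : liftL μ K f = lift μ K f := rfl

/-! ## 2. Substitution in the `X`-variable -/

/-- Values of the lift only depend on the slice `K(x, ·)`: if `K(x, ·) = K'(x', ·)` then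
`lift μ K f x = lift μ K' f x'` (the source of every LEVEL law of a kernel lift). [folklore] -/
theorem lift_apply_eq_of_slice_eq {K K' : C(X × Q, ℂ)} {x x' : X} (h : ∀ q, K (x, q) = K' (x', q))
    (f : C(Q, ℂ)) : lift μ K f x = lift μ K' f x' := by
  rw [lift_apply, lift_apply]
  exact integral_congr_ae (Eventually.of_forall fun q => by simp only [h q])

variable {A : Type*} [TopologicalSpace A] [CompactSpace A]

/-- **Pull-back in the `X`-variable** (restriction to a subgroup, seesaw): lifting by the kernel
`K ∘ (a × id)` is lifting by `K` followed by composition with `a`. [folklore] -/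
theorem lift_pullback (K : C(X × Q, ℂ)) (a : C(A, X)) (f : C(Q, ℂ)) :
    lift (X := A) μ (K.comp (a.prodMap (ContinuousMap.id Q))) f = (lift μ K f).comp a := by
  ext α
  rw [ContinuousMap.comp_apply, lift_apply, lift_apply]
  exact integral_congr_ae (Eventually.of_forall fun q => rfl)

end Lift

/-! ## 3. Substitution in the `Q`-variable under an invariant measure -/

section Invariant

variable {X Q : Type*} [TopologicalSpace X] [CompactSpace X] [TopologicalSpace Q] [CompactSpace Q]
  [MeasurableSpace Q] [BorelSpace Q] (μ : Measure Q) [IsFiniteMeasure μ]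
  {G : Type*} [Group G] [MulAction G Q] [ContinuousConstSMul G Q]

/-- **Change of variables**: if `K'(x, q) = K(x, g • q)` and `f'(q) = f(g • q)` for a `g` under which `μ`
is invariant, then `lift μ K' f' = lift μ K f` (the source of the EQUIVARIANCE law
`Θ_{ω(h)Φ}(λ(h) f) = Θ_Φ(f)` of a theta lift). [folklore] -/
theorem lift_eq_of_smul_invariant [SMulInvariantMeasure G Q μ] (g : G) {K K' : C(X × Q, ℂ)}
    {f f' : C(Q, ℂ)} (hK : ∀ x q, K' (x, q) = K (x, g • q)) (hf : ∀ q, f' q = f (g • q)) :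
    lift μ K' f' = lift μ K f := by
  ext x
  rw [lift_apply, lift_apply]
  simp only [hK, hf]
  exact integral_smul_eq_self (μ := μ) (fun q => K (x, q) * f q)

end Invariant

/-! ## 4. The finite-sum form -/

section FiniteSum

variable {Q : Type*} [MeasurableSpace Q] (μ : Measure Q) [IsFiniteMeasure μ]
  {E : Type*} [NormedAddCommGroup E] [NormedSpace ℝ E] [CompleteSpace E]

/-- **Integration of a function of finitely many measurable classes**: if `c : Q → C` has finite range
type and measurable fibres then `∫ g(c q) dμ(q) = Σ_i μ(c⁻¹{i}) • g i`. [folklore] -/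
theorem integral_comp_eq_sum_fiber {C : Type*} [Fintype C] (c : Q → C)
    (hc : ∀ i, MeasurableSet (c ⁻¹' {i})) (g : C → E) :
    ∫ q, g (c q) ∂μ = ∑ i, μ.real (c ⁻¹' {i}) • g i := by
  have hpt : (fun q => g (c q)) = fun q => ∑ i, (c ⁻¹' {i}).indicator (fun _ => g i) q := by
    funext q
    rw [Finset.sum_eq_single (c q)]
    · rw [Set.indicator_of_mem (show q ∈ c ⁻¹' {c q} by simp)]
    · intro i _ hi
      apply Set.indicator_of_notMem
      intro h
      exact hi (Set.mem_singleton_iff.mp h).symm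
    · intro h
      exact absurd (Finset.mem_univ _) h
  rw [hpt]
  calc ∫ q, ∑ i, (c ⁻¹' {i}).indicator (fun _ => g i) q ∂μ
        = ∑ i, ∫ q, (c ⁻¹' {i}).indicator (fun _ => g i) q ∂μ :=
          integral_finsetSum (f := fun i q => (c ⁻¹' {i}).indicator (fun _ => g i) q) _
            (fun i _ => (integrable_const (g i)).indicator (hc i))
    _ = ∑ i, μ.real (c ⁻¹' {i}) • g i :=
          Finset.sum_congr rfl fun i _ => integral_indicator_const (g i) (hc i)

variable {X : Type*} [TopologicalSpace X] [CompactSpace X] [TopologicalSpace Q] [CompactSpace Q]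
  [OpensMeasurableSpace Q]

/-- **The lift as a finite sum**: if the integrand `q ↦ K(x, q) f(q)` is constant on the fibres of a map
`c : Q → C` to a finite type with measurable fibres (witnessed through a section `rep` of `c`), then
`lift μ K f x = Σ_i μ(c⁻¹{i}) · K(x, rep i) f(rep i)`. [folklore] -/
theorem lift_apply_eq_sum {C : Type*} [Fintype C] (c : Q → C) (hc : ∀ i, MeasurableSet (c ⁻¹' {i}))
    (rep : C → Q) (K : C(X × Q, ℂ)) (f : C(Q, ℂ)) (x : X)
    (h : ∀ q, K (x, q) * f q = K (x, rep (c q)) * f (rep (c q))) :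
    lift μ K f x = ∑ i, (μ.real (c ⁻¹' {i}) : ℂ) * (K (x, rep i) * f (rep i)) := by
  rw [lift_apply]
  calc ∫ q, K (x, q) * f q ∂μ = ∫ q, (fun i => K (x, rep i) * f (rep i)) (c q) ∂μ :=
        integral_congr_ae (Eventually.of_forall h)
    _ = ∑ i, μ.real (c ⁻¹' {i}) • (fun i => K (x, rep i) * f (rep i)) i :=
        integral_comp_eq_sum_fiber μ c hc (fun i => K (x, rep i) * f (rep i))
    _ = ∑ i, (μ.real (c ⁻¹' {i}) : ℂ) * (K (x, rep i) * f (rep i)) :=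
        Finset.sum_congr rfl fun i _ => Complex.real_smul

end FiniteSum

/-! ## 5. Adjointness by duality (no Fubini) -/

section Pairing

variable {X : Type*} [TopologicalSpace X] [CompactSpace X] [MeasurableSpace X] [OpensMeasurableSpace X]
  (ν : Measure X) [IsFiniteMeasure ν]

/-- Products of continuous functions on a compact space are integrable for a finite measure.
[folklore] -/
theorem integrable_mul_continuousMap (φ F : C(X, ℂ)) : Integrable (fun x => φ x * F x) ν :=
  (φ.continuous.mul F.continuous).integrable_of_hasCompactSupport (HasCompactSupport.of_compactSpace _)

/-- **The pairing functional** `φ ↦ ∫ φ(x) F(x) dν(x)` as a continuous linear functional on `C(X, ℂ)`,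
of norm `≤ ν(X) ‖F‖`. [folklore] -/
def pairing (F : C(X, ℂ)) : C(X, ℂ) →L[ℂ] ℂ :=
  LinearMap.mkContinuous
    { toFun := fun φ => ∫ x, φ x * F x ∂ν
      map_add' := fun φ ψ => by
        simp only [ContinuousMap.add_apply, add_mul]
        exact integral_add (integrable_mul_continuousMap ν φ F) (integrable_mul_continuousMap ν ψ F)
      map_smul' := fun c φ => by
        simp only [ContinuousMap.smul_apply, smul_eq_mul, RingHom.id_apply, mul_assoc]
        exact integral_const_mul c _ }
    (ν.real univ * ‖F‖) fun φ => by
      have hb : ∀ x, ‖φ x * F x‖ ≤ ‖φ‖ * ‖F‖ := fun x => by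
        rw [norm_mul]
        exact mul_le_mul (φ.norm_coe_le_norm x) (F.norm_coe_le_norm x) (norm_nonneg _) (norm_nonneg _)
      change ‖∫ x, φ x * F x ∂ν‖ ≤ _
      calc ‖∫ x, φ x * F x ∂ν‖ ≤ ‖φ‖ * ‖F‖ * ν.real univ :=
            norm_integral_le_of_norm_le_const (Eventually.of_forall hb)
        _ = ν.real univ * ‖F‖ * ‖φ‖ := by ring

/-- `pairing ν F φ = ∫ φ F dν`. [folklore] -/
@[simp] theorem pairing_apply (F φ : C(X, ℂ)) : pairing ν F φ = ∫ x, φ x * F x ∂ν := rfl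

variable {Q : Type*} [TopologicalSpace Q] [CompactSpace Q] [MeasurableSpace Q] [OpensMeasurableSpace Q]
  (μ : Measure Q) [IsFiniteMeasure μ]

/-- **Adjointness of the two lifts of one kernel** (`C(X, ℂ)`-valued Bochner integral commuted with
the pairing functional — no product measure, no Fubini):
`∫ (lift μ K f)(x) F(x) dν(x) = ∫ f(q) (lift ν Kᵗ F)(q) dμ(q)`.
[cite: DeitmarEchterhoff2014, §B.6] -/
theorem integral_lift_mul (K : C(X × Q, ℂ)) (f : C(Q, ℂ)) (F : C(X, ℂ)) :
    ∫ x, lift μ K f x * F x ∂ν = ∫ q, f q * lift ν (K.comp ContinuousMap.prodSwap) F q ∂μ := by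
  have h := (pairing ν F).integral_comp_comm (integrable_smul_sliceQ_id μ K f)
  rw [← lift_def] at h
  rw [← pairing_apply ν F (lift μ K f), ← h]
  refine integral_congr_ae (Eventually.of_forall fun q => ?_)
  simp only [map_smul, smul_eq_mul, pairing_apply, sliceQ_apply, lift_apply, comp_prodSwap_apply]

end Pairing

section Seesaw

variable {X : Type*} [TopologicalSpace X] [CompactSpace X]
  {Q : Type*} [TopologicalSpace Q] [CompactSpace Q] [MeasurableSpace Q] [OpensMeasurableSpace Q]
  (μ : Measure Q) [IsFiniteMeasure μ]
  {A : Type*} [TopologicalSpace A] [CompactSpace A] [MeasurableSpace A] [OpensMeasurableSpace A]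
  (νA : Measure A) [IsFiniteMeasure νA]

/-- **Adjointness along a pull-back** (the seesaw shape): for `a : A → X` continuous,
`∫_A (lift μ K f)(a α) F(α) dνA(α) = ∫_Q f(q) (lift νA (K ∘ (a × id))ᵗ F)(q) dμ(q)`. [folklore] -/
theorem integral_lift_comp_mul (K : C(X × Q, ℂ)) (a : C(A, X)) (f : C(Q, ℂ)) (F : C(A, ℂ)) :
    ∫ α, lift μ K f (a α) * F α ∂νA =
      ∫ q, f q * lift νA ((K.comp (a.prodMap (ContinuousMap.id Q))).comp ContinuousMap.prodSwap) F q ∂μ := by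
  rw [← integral_lift_mul νA μ]
  refine integral_congr_ae (Eventually.of_forall fun α => ?_)
  simp only [lift_pullback, ContinuousMap.comp_apply]

end Seesaw

end KernelOp

end Literature.MeasureTheory.Integral

end
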